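import Summits.BirchSwinnertonDyer.BirchSwinnertonDyer.Theorems.SignedBaseChangeAnticyclotomicEisensteinDivisibilityFiniteExponentTelescope
import Literature.NumberTheory.IwasawaTheory.Greenberg2006.LocalH2VanishingOfLOC1
import HarnessLib

/-!
# Line `bdpline` on the crux `AnticyclotomicEisensteinDivisibility` (stmt-BirchSwinnertonDyer-20727):
# the stub `stub_greenberg2016FactsSS` from FIVE named facts — Greenberg 2006 §5 A is now a theorem

Width seat bsd-line-sbc-p1-w4 (gen 2), `--supports stmt-BirchSwinnertonDyer-20727`. The registered stub
`stub_greenberg2016FactsSS` of the skeleton of record (bdpline v23) is the conjunction of SIX typed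
published facts of the Greenberg-2016 road: Greenberg 2016 Props. 4.1.1, 4.2.2 and Greenberg 2006 §5 A,
Props. 4.1, 4.2, 3.2. The third, `Greenberg2006.sec5A_localH2_subsingleton_of_LOC1`
(`LOC_v⁽¹⁾(𝒟) ⟹ H²(K_v, 𝒟) = 0`), is PROVED in the tree
(`Literature/NumberTheory/IwasawaTheory/Greenberg2006/LocalH2VanishingOfLOC1.lean`,
`sec5A_localH2_subsingleton_of_LOC1_holds`: local Tate duality `(2,0)` on the finite levels + König).
This file records the consequences for the line:

* `greenberg2016FactsSS_of_five` — the stub's six-fold conjunction (its registered TYPE, verbatim) from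
  the remaining FIVE facts; the LEAD may reshape the stub to the five-fold conjunction and derive the
  registered one by this name.
* `finiteExponent_of_bricks_five` — the telescope `…FiniteExponentTelescope.finiteExponent_of_bricks`
  (which derives `stub_finiteExponentSS` from (R1a), (R1b) and the six facts) with the hypothesis `h5A`
  discharged.

Theorems only; the five remaining facts are hypotheses (named, refereed, typed); nothing about elliptic
curves is asserted unconditionally beyond that; BSD / the crux are NOT proved by this file.
-/

-- D-0017: single-problem summit, the namespace repeats the problem name by design.
set_option linter.dupNamespace false
set_option autoImplicit false

noncomputable section

open scoped Classical
open NumberField IsDedekindDomain Field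
open Literature.NumberTheory.EllipticCurves Literature.NumberTheory.GaloisRepresentations
  Literature.NumberTheory.EllipticCurves.Rubin1991
  Literature.NumberTheory.IwasawaTheory Literature.NumberTheory.IwasawaTheory.Greenberg2006
  Literature.NumberTheory.IwasawaTheory.Greenberg2016
  Summit.BirchSwinnertonDyer.BirchSwinnertonDyer.Theorems.SignedBaseChangeAcDivCurveModel
  Summit.BirchSwinnertonDyer.BirchSwinnertonDyer.Theorems.SignedBaseChangeAcDivAssembly
  Summit.BirchSwinnertonDyer.BirchSwinnertonDyer.Theorems.SignedBaseChangeAcDivFiniteExponentTelescope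

namespace Summit.BirchSwinnertonDyer.BirchSwinnertonDyer.Theorems.SignedBaseChangeAcDivGreenbergFiveFacts

/-- **`stub_greenberg2016FactsSS` from FIVE facts**: the registered six-fold conjunction
`prop411 ∧ prop422 ∧ sec5A ∧ prop41 ∧ prop42 ∧ prop32`, with the third conjunct supplied by the tree's
theorem `Greenberg2006.sec5A_localH2_subsingleton_of_LOC1_holds`.
[cite: Greenberg2016Selmer, Props. 4.1.1, 4.2.2] [cite: Greenberg2006, Props. 3.2, 4.1, 4.2, §5 A] -/
theorem greenberg2016FactsSS_of_five
    (h411 : prop411_selmer_isAlmostDivisible) (h422 : prop422_localCohomology_isAlmostDivisible)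
    (h41 : prop41_globalEulerPoincareCorank) (h42 : prop42_localEulerPoincareCorank)
    (h32 : prop32_cohomology_isCofinitelyGenerated) :
    Literature.NumberTheory.IwasawaTheory.Greenberg2016.prop411_selmer_isAlmostDivisible ∧ Literature.NumberTheory.IwasawaTheory.Greenberg2016.prop422_localCohomology_isAlmostDivisible ∧ Literature.NumberTheory.IwasawaTheory.Greenberg2006.sec5A_localH2_subsingleton_of_LOC1 ∧ Literature.NumberTheory.IwasawaTheory.Greenberg2006.prop41_globalEulerPoincareCorank ∧ Literature.NumberTheory.IwasawaTheory.Greenberg2006.prop42_localEulerPoincareCorank ∧ Literature.NumberTheory.IwasawaTheory.Greenberg2006.prop32_cohomology_isCofinitelyGenerated :=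
  ⟨h411, h422, sec5A_localH2_subsingleton_of_LOC1_holds, h41, h42, h32⟩

variable {K : Type} [Field K] [NumberField K] {p : ℕ} [Fact p.Prime] (W : WeierstrassCurve K) [W.IsElliptic]
  [TopologicalSpace (PowerSeries ℤ_[p])] [TopologicalSpace (PowerSeries (PowerSeries ℤ_[p]))]
  [IsTopologicalRing (PowerSeries (PowerSeries ℤ_[p]))]
  [IsTopologicalAddGroup (IndModule₂ ℤ_[p] p (PrimaryTorsion W.geomPoints p))]
  [ContinuousSMul (PowerSeries (PowerSeries ℤ_[p])) (IndModule₂ ℤ_[p] p (PrimaryTorsion W.geomPoints p))]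
  (κ₁ κ₂ : ZpExtension K p) (vbar : HeightOneSpectrum (𝓞 K)) (γ₁ γ₂ : absoluteGaloisGroup K)
  [hγ : Fact (ZpExtension.IsTopGeneratorPair κ₁ κ₂ γ₁ γ₂)]

/-- **The finite-exponent telescope with `h5A` discharged**: `…FiniteExponentTelescope.finiteExponent_of_bricks`
(`stub_finiteExponentSS` from (R1a), (R1b) and the published facts) needs only the FIVE remaining named
facts, Greenberg 2006 §5 A being the tree's theorem `sec5A_localH2_subsingleton_of_LOC1_holds`.
[cite: Greenberg2016Selmer, Prop. 4.1.1 (c) (§4.1 p. 15)] [cite: Greenberg2006, Props. 3.2, 4.1, 4.2, §5 A]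
[cite: Greenberg2010, Lemma 5.2.2] -/
theorem finiteExponent_of_bricks_five
    (h411 : prop411_selmer_isAlmostDivisible) (h422 : prop422_localCohomology_isAlmostDivisible)
    (h41 : prop41_globalEulerPoincareCorank)
    (h42 : prop42_localEulerPoincareCorank) (h32 : prop32_cohomology_isCofinitelyGenerated)
    (hp : 2 < p) (hK : IsImaginaryQuadratic K)
    {v : HeightOneSpectrum (𝓞 K)} (hv : ((p : ℕ) : 𝓞 K) ∈ v.asIdeal)
    (hvbar : ((p : ℕ) : 𝓞 K) ∈ vbar.asIdeal) (hne : vbar ≠ v)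
    (hcofree : IsCofree ℤ_[p] (PrimaryTorsion W.geomPoints p))
    (hTate : ∃ (Y : Type) (_ : AddCommGroup Y) (_ : Module ℤ_[p] Y)
      (tA : Y →+ (PrimaryTorsion W.geomPoints p →+ DiscreteGaloisModule.UnitsCarrier K))
      (_ : IsDualPairing ℤ_[p] (PrimaryTorsion W.geomPoints p) tA) (n : ℕ),
      Nonempty (Module.Basis (Fin n) ℤ_[p] Y))
    (hR1b : ∀ (ρ₀ : ContinuousRep
        (GaloisGroupUnramifiedOutside K {w : HeightOneSpectrum (𝓞 K) | ((p : ℕ) : 𝓞 K) ∈ w.asIdeal ∨ ¬ W.HasGoodReductionAt w})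
        ℤ_[p] (PrimaryTorsion W.geomPoints p)),
      (∀ (σ : absoluteGaloisGroup K) (P : PrimaryTorsion W.geomPoints p),
        ρ₀ (toUnramifiedQuot K _ σ) P = σ • P) →
      (∀ w : HeightOneSpectrum (𝓞 K), w ∈ {w : HeightOneSpectrum (𝓞 K) | ((p : ℕ) : 𝓞 K) ∈ w.asIdeal ∨ ¬ W.HasGoodReductionAt w} →
          LOC1 _ (twistDeformation _ (mem_badOrP_of_natCast_mem W p) κ₁ κ₂ ρ₀) (Sum.inr w)) ∧
        (∀ w : HeightOneSpectrum (𝓞 K), w ∈ {w : HeightOneSpectrum (𝓞 K) | ((p : ℕ) : 𝓞 K) ∈ w.asIdeal ∨ ¬ W.HasGoodReductionAt w} →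
          HasCorank (IwasawaAlgebra₂ p)
            ((localRep _ (twistDeformation _ (mem_badOrP_of_natCast_mem W p) κ₁ κ₂ ρ₀) (Sum.inr w)).H 0) 0) ∧
        HasCorank (IwasawaAlgebra₂ p)
          ((twistDeformation _ (mem_badOrP_of_natCast_mem W p) κ₁ κ₂ ρ₀).H 0) 0)
    (h0 : Literature.NumberTheory.EllipticCurves.Module.lengthAt (IwasawaAlgebra₂ p) (W.XGr₂ p κ₁ κ₂ vbar γ₁ γ₂)
      ⟨Ideal.span {(PowerSeries.X : IwasawaAlgebra₂ p)}, PowerSeries.span_X_isPrime⟩ = 0) :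
    ∃ m : ℕ, ∀ x : W.XGr₂ p κ₁ κ₂ vbar γ₁ γ₂,
      (PowerSeries.X : IwasawaAlgebra₂ p) • x = 0 → ((p : IwasawaAlgebra₂ p) ^ m) • x = 0 :=
  finiteExponent_of_bricks W κ₁ κ₂ vbar γ₁ γ₂ h411 h422 sec5A_localH2_subsingleton_of_LOC1_holds h41 h42
    h32 hp hK hv hvbar hne hcofree hTate hR1b h0

end Summit.BirchSwinnertonDyer.BirchSwinnertonDyer.Theorems.SignedBaseChangeAcDivGreenbergFiveFacts

end
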